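import Summits.QuantumFields.BalabanUV.Beta.EriceRemainderEnclosureHistoryAutonomyComparisonNonlinearRow
import Summits.QuantumFields.BalabanUV.Beta.EriceRemainderEnclosureHistoryAutonomyComparisonAgeCompositionDampedLevelGaugePrep

/-!
# EriceRemainderEnclosureHistoryAutonomyComparisonNonlinearLevelGaugePrep — (E118c) preparations for THE NONLINEAR LEVEL GAUGE: the CONSTANT EXCESS
# `B′ = B + η` over the affine memory `B u = β₀ + Σ_{k<K} L_k·u_k` (`β₀ > 0`, `L ≥ 0`, `L_0 = 0`, ANY profile, any size, `η ≥ 0`).  Along the base orbit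
# `h = S y` let `X_m = B′(S′h_m) − B(S h_m)` (the STEP quantity at the orbit pin `h_m`), `a_m = 1∕h_m²`, `u_m = (a_{m+1} − a_m)∕a_{m+1}`, `F(m) = Σ_{1≤k<K} L_kh_{m+k}³∕2`,
# `T(m) = Σ_{1≤k<K} k·L_kh_{m+k}³∕2`.  §1 the constant excess as an instance of (E118b)'s setting (`const_facts`: isotone, floor, modulus, excess `η` with modulus
# `0`); comparison from the non-negativity of the deeper step quantities (`cmp_of_steps_nonneg`, (E49k) `family_le_of_orbit`).  §2 `step_le_eta` (`X_m ≤ η` under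
# comparison), `conf_gap_le` (`δ^{(m)}_k ≤ k·η`), `step_ge_eta` (`X_m ≥ η·(1 − T(m))`).  §3 flow facts: `loads_le` (`T ≤ (K−1)·F`), `relstep_antitone` (`u` non-increasing),
# `exists_base_depth` (deep enough, `u_n ≤ 1∕(5(K+1))` and the pin is small: `(Σ_k L_k)·h_n ≤ (3√3∕2)·β₀`).  The sequels: (E118d) `…NonlinearLevelGaugeBase` (the gauge
# in the deep region by crude window bounds) and (E118e) `…NonlinearLevelGauge` (the row induction and the comparison theorem for the constant excess).

Cell `pub-balaban`, β-function sub-cell, BINDER row D4 «RemainderConst leaves for Bałaban's split» (`HOME/BINDER-OWNERS.md`; owner lineage `b2b-balaban-beta-an4`;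
this file by co-owner #2 lineage `b2b-balaban-beta-d4-p2`, generation 98), β-FLOW TEAM duty (1), FREEZE (0) honoured (def-free; imports (E118b) `…NonlinearRow` and
(E117a) `…DampedLevelGaugePrep`; uses (E118a) `affine_facts` ∕ `step_eq_drop` ∕ `sum_range_eq_Ico_of_zero`, (E63a) `levelGap_le_sum_step`, (E49k)
`family_le_of_orbit`, (E58b) `increment_anti`, (E48a) `family_mem` ∕ `family_tail_eq` ∕ `family_zero` ∕ `strictAnti_of_memFlow`, node U2's `invSq_eq_of_memFlow` ∕
`mul_lower_le_drive` ∕ `Sharpness.abs_sub_le_half_cube_mul` BY NAME; nothing restated).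

HONEST FRAMING (page 1, verbatim and binding).  *"Discharging BetaPertH makes Bałaban's UV stability UNCONDITIONAL — a real constructive-QFT result; it is
NOT the continuum limit and NOT the Clay problem."*  THIS FILE DISCHARGES NOTHING OF THE KIND.  Elementary real analysis about ABSTRACT functionals on a box
]0,γ]^ℕ with displayed floors, moduli, profiles and signs — hypotheses of a census, not facts; the form, signs, ages and moments of Bałaban's (1.22) limit
functional are NOT PRINTED ([I] p. 298; GAPS G-t4-U2-1∕-2) and NOT asserted.  Row D4 class UNCHANGED (critical-path width 0; instance 0∕1; D4 DISCHARGE NO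
DATE).  HONEST DEPENDENCY: continuum YM on T⁴ ⇐ BetaPertH ∧ nine spine estimates (0/9 proved); BetaPertH ⇐ (D1) ∧ (D4) ∧ CAP+tail; G-an2-4 gates asym, D1
and NE2/3/4.  NOT CLAIMED here: the comparison theorem itself (the sequel); anything printed — NOT B12 Thm 2, NOT BetaPertH, NOT continuum, NOT Clay.

WHAT IS PROVED ([folklore]; 0 `def`, 0 sorry).  §1 `const_facts`, **`cmp_of_steps_nonneg`**.  §2 `step_le_eta`, `conf_gap_le`, **`step_ge_eta`**.  §3 `loads_le`,
`relstep_antitone`, `relstep_mem`, **`exists_base_depth`**.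
-/

noncomputable section
open Finset Set

namespace Summit.QuantumFields.BalabanUV.Beta.EriceRemainderEnclosureHistoryAutonomyComparisonNonlinearLevelGaugePrep

open Literature.MathematicalPhysics.QuantumFieldTheory.Balaban1983to89
open Literature.MathematicalPhysics.QuantumFieldTheory.Balaban1983to89.T4BetaStationary
open Literature.MathematicalPhysics.QuantumFieldTheory.Balaban1983to89.T4BetaFlowWellPosed
open Literature.MathematicalPhysics.QuantumFieldTheory.Balaban1983to89.T4BetaFlowWellPosed.Sharpness (abs_sub_le_half_cube_mul)
open Summit.QuantumFields.BalabanUV.Beta.EriceRemainderEnclosureHistoryAutonomyOrder (family_mem family_tail_eq family_zero strictAnti_of_memFlow)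
open Summit.QuantumFields.BalabanUV.Beta.EriceRemainderEnclosureHistoryAutonomyComparisonIsotoneExcess (family_le_of_orbit)
open Summit.QuantumFields.BalabanUV.Beta.EriceRemainderEnclosureHistoryAutonomyComparisonDropBound (levelGap_le_sum_step)
open Summit.QuantumFields.BalabanUV.Beta.EriceRemainderEnclosureHistoryAutonomyComparisonAffineProfile (increment_anti)
open Summit.QuantumFields.BalabanUV.Beta.EriceRemainderEnclosureHistoryAutonomyComparisonAgeCompositionHeatingCriterionFlow (flow_budget_le flow_rate_decay_le)
open Summit.QuantumFields.BalabanUV.Beta.EriceRemainderEnclosureHistoryAutonomyComparisonAgeCompositionDampedLevelGaugePrep (flow_first_entry_le)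
open Summit.QuantumFields.BalabanUV.Beta.EriceRemainderEnclosureHistoryAutonomyComparisonNonlinearRowPrep (affine_facts step_eq_drop sum_range_eq_Ico_of_zero)
open Summit.QuantumFields.BalabanUV.Beta.EriceRemainderEnclosureHistoryAutonomyComparisonNonlinearRow (row_ge)

variable {B B' : (ℕ → ℝ) → ℝ} {γ β₀ η : ℝ} {L : ℕ → ℝ} {K : ℕ} {S S' : ℝ → ℕ → ℝ}

/-! ## §1 The constant excess: the setting of (E118b), comparison from the deeper step quantities -/

/-- The constant excess `B′ = B + η` (`η ≥ 0`) over the affine memory: `B′` is isotone with floor `β₀` and modulus `Σ_k L_k`, `B ≤ B′`, the excess is isotone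
(constant) and has modulus `0` along ordered pairs. [folklore] -/
theorem const_facts (hBaff : ∀ u, SeqBox γ u → B u = β₀ + ∑ k ∈ range K, L k * u k) (hL : ∀ k, 0 ≤ L k) (hβ : 0 < β₀)
    (hB'eq : ∀ u, SeqBox γ u → B' u = B u + η) (hη : 0 ≤ η) :
    (∀ u v : ℕ → ℝ, SeqBox γ u → SeqBox γ v → (∀ j, u j ≤ v j) → B' u ≤ B' v)
      ∧ (∀ u, SeqBox γ u → β₀ ≤ B' u)
      ∧ (∀ u u' : ℕ → ℝ, SeqBox γ u → SeqBox γ u' → ∀ D : ℝ, (∀ j, |u j - u' j| ≤ D) → |B' u - B' u'| ≤ (∑ k ∈ range K, L k) * D)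
      ∧ (∀ u, SeqBox γ u → B u ≤ B' u)
      ∧ (∀ u v : ℕ → ℝ, SeqBox γ u → SeqBox γ v → (∀ j, u j ≤ v j) → B' u - B u ≤ B' v - B v)
      ∧ (∀ u u' : ℕ → ℝ, SeqBox γ u → SeqBox γ u' → (∀ j, u' j ≤ u j) → ∀ D : ℝ, 0 ≤ D → (∀ j, u j - u' j ≤ D) →
          (B' u - B u) - (B' u' - B u') ≤ 0 * D) := by
  obtain ⟨hmono, hlo, _, hmod⟩ := affine_facts hBaff hL hβ
  refine ⟨fun u v hu hv hle => ?_, fun u hu => ?_, fun u u' hu hu' D hD => ?_, fun u hu => ?_, fun u v hu hv _ => ?_, fun u u' hu hu' _ D _ _ => ?_⟩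
  · rw [hB'eq u hu, hB'eq v hv]; linarith [hmono u v hu hv hle]
  · rw [hB'eq u hu]; linarith [hlo u hu]
  · rw [hB'eq u hu, hB'eq u' hu', show B u + η - (B u' + η) = B u - B u' by ring]; exact hmod u u' hu hu' D hD
  · rw [hB'eq u hu]; linarith
  · rw [hB'eq u hu, hB'eq v hv]; linarith
  · rw [hB'eq u hu, hB'eq u' hu']; linarith

/-- **COMPARISON FROM NON-NEGATIVE DEEPER STEP QUANTITIES.**  If `X_m ≥ 0` at every orbit pin `h_m`, `m ≥ n+1`, then every configuration `m ≥ n` compares: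
`S′(h_m)_j ≤ h_{m+j}` ((E49k) `family_le_of_orbit`: the orbit of `h_m` is `h_{m+j}`). [folklore] -/
theorem cmp_of_steps_nonneg (hBaff : ∀ u, SeqBox γ u → B u = β₀ + ∑ k ∈ range K, L k * u k) (hL : ∀ k, 0 ≤ L k) (hβ : 0 < β₀)
    (hB'eq : ∀ u, SeqBox γ u → B' u = B u + η) (hη : 0 ≤ η)
    (hS : ∀ p, 0 < p → p ≤ γ → SeqBox γ (S p) ∧ MemFlow B p (S p))
    (huniq : ∀ p, 0 < p → p ≤ γ → ∀ u u' : ℕ → ℝ, SeqBox γ u → SeqBox γ u' → MemFlow B p u → MemFlow B p u' → u = u')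
    (hS' : ∀ p, 0 < p → p ≤ γ → SeqBox γ (S' p) ∧ MemFlow B' p (S' p))
    (huniq' : ∀ p, 0 < p → p ≤ γ → ∀ u u' : ℕ → ℝ, SeqBox γ u → SeqBox γ u' → MemFlow B' p u → MemFlow B' p u' → u = u')
    {y : ℝ} (hy : 0 < y) (hyγ : y ≤ γ) (n : ℕ) (hX : ∀ m, n + 1 ≤ m → 0 ≤ B' (S' (S y m)) - B (S (S y m))) :
    ∀ m, n ≤ m → ∀ j, S' (S y m) j ≤ S y (m + j) := by
  obtain ⟨_, hlo', hB', _, _, _⟩ := const_facts hBaff hL hβ hB'eq hη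
  intro m hm j
  have hq := family_mem hS hy hyγ m
  have hγ : 0 < γ := hy.trans_le hyγ
  have htail : ∀ i, S (S y m) i = S y (m + i) := fun i => (congrFun (family_tail_eq hS huniq hy hyγ m) i).symm
  have hQ : ∀ i, 1 ≤ i → B (S (S (S y m) i)) ≤ B' (S' (S (S y m) i)) := by
    intro i hi; rw [htail i]; linarith [hX (m + i) (by omega)]
  have := family_le_of_orbit hβ hγ hB' (sum_nonneg fun k _ => hL k) hlo' hS huniq hS' huniq' ⟨hq.1, hq.2⟩ hQ j
  rwa [htail j] at this

/-! ## §2 The step quantity between `η(1 − T)` and `η` -/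

/-- Under comparison in configuration `m`, `X_m ≤ η` (the affine drop is non-negative). [folklore] -/
theorem step_le_eta (hBaff : ∀ u, SeqBox γ u → B u = β₀ + ∑ k ∈ range K, L k * u k) (hL : ∀ k, 0 ≤ L k)
    (hB'eq : ∀ u, SeqBox γ u → B' u = B u + η)
    (hS : ∀ p, 0 < p → p ≤ γ → SeqBox γ (S p) ∧ MemFlow B p (S p))
    (huniq : ∀ p, 0 < p → p ≤ γ → ∀ u u' : ℕ → ℝ, SeqBox γ u → SeqBox γ u' → MemFlow B p u → MemFlow B p u' → u = u')
    (hS' : ∀ p, 0 < p → p ≤ γ → SeqBox γ (S' p) ∧ MemFlow B' p (S' p))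
    {y : ℝ} (hy : 0 < y) (hyγ : y ≤ γ) (m : ℕ) (hcmp : ∀ j, S' (S y m) j ≤ S y (m + j)) :
    B' (S' (S y m)) - B (S (S y m)) ≤ η := by
  have hq := family_mem hS hy hyγ m
  rw [step_eq_drop hBaff hS huniq hS' hy hyγ m, hB'eq _ (hS' _ hq.1 hq.2).1, add_sub_cancel_left]
  have : 0 ≤ ∑ k ∈ range K, L k * (S y (m + k) - S' (S y m) k) := sum_nonneg fun k _ => mul_nonneg (hL k) (by linarith [hcmp k])
  linarith

/-- Under comparison from every pin `h_{m′}`, `m′ ≥ m`, the level gap of configuration `m` at depth `k` is at most `k·η` ((E63a) `levelGap_le_sum_step` and `step_le_eta`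
at the deeper pins). [folklore] -/
theorem conf_gap_le (hBaff : ∀ u, SeqBox γ u → B u = β₀ + ∑ k ∈ range K, L k * u k) (hL : ∀ k, 0 ≤ L k) (hβ : 0 < β₀)
    (hB'eq : ∀ u, SeqBox γ u → B' u = B u + η) (hη : 0 ≤ η)
    (hS : ∀ p, 0 < p → p ≤ γ → SeqBox γ (S p) ∧ MemFlow B p (S p))
    (huniq : ∀ p, 0 < p → p ≤ γ → ∀ u u' : ℕ → ℝ, SeqBox γ u → SeqBox γ u' → MemFlow B p u → MemFlow B p u' → u = u')
    (hS' : ∀ p, 0 < p → p ≤ γ → SeqBox γ (S' p) ∧ MemFlow B' p (S' p))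
    (huniq' : ∀ p, 0 < p → p ≤ γ → ∀ u u' : ℕ → ℝ, SeqBox γ u → SeqBox γ u' → MemFlow B' p u → MemFlow B' p u' → u = u')
    {y : ℝ} (hy : 0 < y) (hyγ : y ≤ γ) (m : ℕ) (hcmp : ∀ m', m ≤ m' → ∀ j, S' (S y m') j ≤ S y (m' + j)) (k : ℕ) :
    1 / S' (S y m) k ^ 2 - 1 / S y (m + k) ^ 2 ≤ (k : ℝ) * η := by
  obtain ⟨hmono', hlo', hB', _, _, _⟩ := const_facts hBaff hL hβ hB'eq hη
  have hq := family_mem hS hy hyγ m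
  have hM' : 0 ≤ ∑ k ∈ range K, L k := sum_nonneg fun k _ => hL k
  have htail : ∀ i, S (S y m) i = S y (m + i) := fun i => (congrFun (family_tail_eq hS huniq hy hyγ m) i).symm
  have hle : ∀ j, S' (S y m) j ≤ S (S y m) j := fun j => by rw [htail j]; exact hcmp m le_rfl j
  have h1 := levelGap_le_sum_step hmono' hβ hB' hM' hlo' hS huniq hS' huniq' (hS _ hq.1 hq.2).1 (hS _ hq.1 hq.2).2
    (hS' _ hq.1 hq.2).1 (hS' _ hq.1 hq.2).2 hle k
  rw [htail k] at h1
  refine h1.trans ?_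
  have hterm : ∀ l ∈ range k, B' (S' (S (S y m) (l + 1))) - B (S (S (S y m) (l + 1))) ≤ η := by
    intro l _
    rw [htail (l + 1)]
    exact step_le_eta hBaff hL hB'eq hS huniq hS' hy hyγ (m + (l + 1)) (hcmp (m + (l + 1)) (by omega))
  calc ∑ l ∈ range k, (B' (S' (S (S y m) (l + 1))) - B (S (S (S y m) (l + 1)))) ≤ ∑ l ∈ range k, η := sum_le_sum hterm
    _ = (k : ℝ) * η := by rw [sum_const, card_range, nsmul_eq_mul]

/-- **`X_m ≥ η·(1 − T(m))`** with the row mass `T(m) = Σ_{1≤k<K} k·L_kh_{m+k}³∕2`, under comparison from every pin `h_{m′}`, `m′ ≥ m` (coupling gap ≤ cube∕2 ×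
level gap, `conf_gap_le`). [folklore] -/
theorem step_ge_eta (hBaff : ∀ u, SeqBox γ u → B u = β₀ + ∑ k ∈ range K, L k * u k) (hL : ∀ k, 0 ≤ L k) (hβ : 0 < β₀)
    (hB'eq : ∀ u, SeqBox γ u → B' u = B u + η) (hη : 0 ≤ η)
    (hS : ∀ p, 0 < p → p ≤ γ → SeqBox γ (S p) ∧ MemFlow B p (S p))
    (huniq : ∀ p, 0 < p → p ≤ γ → ∀ u u' : ℕ → ℝ, SeqBox γ u → SeqBox γ u' → MemFlow B p u → MemFlow B p u' → u = u')
    (hS' : ∀ p, 0 < p → p ≤ γ → SeqBox γ (S' p) ∧ MemFlow B' p (S' p))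
    (huniq' : ∀ p, 0 < p → p ≤ γ → ∀ u u' : ℕ → ℝ, SeqBox γ u → SeqBox γ u' → MemFlow B' p u → MemFlow B' p u' → u = u')
    {y : ℝ} (hy : 0 < y) (hyγ : y ≤ γ) (m : ℕ) (hcmp : ∀ m', m ≤ m' → ∀ j, S' (S y m') j ≤ S y (m' + j)) :
    η * (1 - ∑ k ∈ Ico 1 K, (k : ℝ) * (L k * S y (m + k) ^ 3 / 2)) ≤ B' (S' (S y m)) - B (S (S y m)) := by
  have hq := family_mem hS hy hyγ m
  have hpos : ∀ j, 0 < S y j := fun j => ((hS y hy hyγ).1 j).1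
  have hw := hS' _ hq.1 hq.2
  rw [step_eq_drop hBaff hS huniq hS' hy hyγ m, hB'eq _ hw.1, add_sub_cancel_left,
    sum_range_eq_Ico_of_zero (f := fun k => L k * (S y (m + k) - S' (S y m) k)) (by simp [family_zero hS' hq.1 hq.2])]
  rw [mul_sub, mul_one, mul_sum]
  have hterm : ∀ k ∈ Finset.Ico 1 K, L k * (S y (m + k) - S' (S y m) k) ≤ η * ((k : ℝ) * (L k * S y (m + k) ^ 3 / 2)) := by
    intro k _
    have hc := hcmp m le_rfl k
    have h1 := hpos (m + k); have h2 := (hw.1 k).1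
    have habs := abs_sub_le_half_cube_mul h1 h2 le_rfl hc
    have hg0 : 0 ≤ S y (m + k) - S' (S y m) k := by linarith
    have hd0 : 0 ≤ 1 / S' (S y m) k ^ 2 - 1 / S y (m + k) ^ 2 :=
      sub_nonneg.mpr (one_div_le_one_div_of_le (pow_pos h2 2) (pow_le_pow_left₀ h2.le hc 2))
    rw [abs_of_nonneg hg0, abs_sub_comm, abs_of_nonneg hd0] at habs
    have hgap := conf_gap_le hBaff hL hβ hB'eq hη hS huniq hS' huniq' hy hyγ m hcmp k
    have := habs.trans (mul_le_mul_of_nonneg_left hgap (by positivity))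
    calc L k * (S y (m + k) - S' (S y m) k) ≤ L k * (S y (m + k) ^ 3 / 2 * ((k : ℝ) * η)) := mul_le_mul_of_nonneg_left this (hL k)
      _ = η * ((k : ℝ) * (L k * S y (m + k) ^ 3 / 2)) := by ring
  linarith [sum_le_sum hterm]

/-! ## §3 Flow facts: loads, the relative level step, the deep region -/

/-- `T(m) ≤ (K − 1)·F(m)`: every loaded age is `< K`. [folklore] -/
theorem loads_le (hL : ∀ k, 0 ≤ L k) {h : ℕ → ℝ} (hpos : ∀ j, 0 < h j) (m : ℕ) :
    ∑ k ∈ Ico 1 K, (k : ℝ) * (L k * h (m + k) ^ 3 / 2) ≤ ((K : ℝ) - 1) * ∑ k ∈ Ico 1 K, L k * h (m + k) ^ 3 / 2 := by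
  rw [mul_sum]
  refine sum_le_sum fun k hk => ?_
  have hkK : (k : ℝ) ≤ (K : ℝ) - 1 := by
    have := (mem_Ico.mp hk).2
    have : (k : ℝ) + 1 ≤ K := by exact_mod_cast this
    linarith
  exact mul_le_mul_of_nonneg_right hkK (by have := hL k; have := hpos (m + k); positivity)

/-- **THE RELATIVE LEVEL STEP `u_t = (a_{t+1} − a_t)∕a_{t+1}` IS NON-INCREASING** along a box solution of an isotone memory with floor (increments non-increasing,
levels increasing). [folklore] -/
theorem relstep_antitone {b gIR : ℝ} {h : ℕ → ℝ} (hmono : ∀ u v : ℕ → ℝ, SeqBox γ u → SeqBox γ v → (∀ j, u j ≤ v j) → B u ≤ B v) (hb : 0 < b)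
    (hlo : ∀ u, SeqBox γ u → b ≤ B u) (hh : SeqBox γ h) (hf : MemFlow B gIR h) {t t' : ℕ} (htt' : t ≤ t') :
    (1 / h (t' + 1) ^ 2 - 1 / h t' ^ 2) * h (t' + 1) ^ 2 ≤ (1 / h (t + 1) ^ 2 - 1 / h t ^ 2) * h (t + 1) ^ 2 := by
  have hpos : ∀ j, 0 < h j := fun j => (hh j).1
  have hanti := (strictAnti_of_memFlow hb hlo hh hf).antitone
  have hinc : 1 / h (t' + 1) ^ 2 - 1 / h t' ^ 2 ≤ 1 / h (t + 1) ^ 2 - 1 / h t ^ 2 := by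
    rw [hf.2 t', hf.2 t]; have := increment_anti hmono hb hlo hh hf htt'; linarith
  have hinc0 : 0 ≤ 1 / h (t' + 1) ^ 2 - 1 / h t' ^ 2 := by rw [hf.2 t']; linarith [hlo _ (seqBox_shift hh (t' + 1))]
  have hsq : h (t' + 1) ^ 2 ≤ h (t + 1) ^ 2 := pow_le_pow_left₀ (hpos _).le (hanti (by omega)) 2
  calc (1 / h (t' + 1) ^ 2 - 1 / h t' ^ 2) * h (t' + 1) ^ 2 ≤ (1 / h (t' + 1) ^ 2 - 1 / h t' ^ 2) * h (t + 1) ^ 2 :=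
        mul_le_mul_of_nonneg_left hsq hinc0
    _ ≤ (1 / h (t + 1) ^ 2 - 1 / h t ^ 2) * h (t + 1) ^ 2 := mul_le_mul_of_nonneg_right hinc (sq_nonneg _)

/-- `u_t < 1` and `0 ≤ u_t`. [folklore] -/
theorem relstep_mem {b gIR : ℝ} {h : ℕ → ℝ} (hb : 0 < b) (hlo : ∀ u, SeqBox γ u → b ≤ B u) (hh : SeqBox γ h) (hf : MemFlow B gIR h) (t : ℕ) :
    0 ≤ (1 / h (t + 1) ^ 2 - 1 / h t ^ 2) * h (t + 1) ^ 2 ∧ (1 / h (t + 1) ^ 2 - 1 / h t ^ 2) * h (t + 1) ^ 2 < 1 := by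
  have hpos : ∀ j, 0 < h j := fun j => (hh j).1
  have h1 := hpos (t + 1); have h0 := hpos t
  have hinc0 : 0 ≤ 1 / h (t + 1) ^ 2 - 1 / h t ^ 2 := by rw [hf.2 t]; linarith [hlo _ (seqBox_shift hh (t + 1))]
  refine ⟨mul_nonneg hinc0 (sq_nonneg _), ?_⟩
  have e : (1 / h (t + 1) ^ 2 - 1 / h t ^ 2) * h (t + 1) ^ 2 = 1 - h (t + 1) ^ 2 / h t ^ 2 := by field_simp
  rw [e]
  have : 0 < h (t + 1) ^ 2 / h t ^ 2 := by positivity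
  linarith

/-- **THE DEEP REGION EXISTS**: along a box solution of the affine memory from any pin there is a depth `N₀` beyond which the relative level step is at most
`1∕(5K)` and the pin is small, `(Σ_k L_k)·h_n ≤ (3√3∕2)·β₀` (levels grow at least linearly: `a_n ≥ a_0 + n·β₀`). [folklore] -/
theorem exists_base_depth (hBaff : ∀ u, SeqBox γ u → B u = β₀ + ∑ k ∈ range K, L k * u k) (hL : ∀ k, 0 ≤ L k) (hβ : 0 < β₀)
    {gIR : ℝ} {h : ℕ → ℝ} (hh : SeqBox γ h) (hf : MemFlow B gIR h) :
    ∃ N₀ : ℕ, ∀ n, N₀ ≤ n →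
      (1 / h (n + 1) ^ 2 - 1 / h n ^ 2) * h (n + 1) ^ 2 ≤ 1 / (5 * ((K : ℝ) + 1))
        ∧ (∑ k ∈ range K, L k) * h n ≤ 3 * Real.sqrt 3 / 2 * β₀ := by
  obtain ⟨hmono, hlo, _, _⟩ := affine_facts hBaff hL hβ
  have hpos : ∀ j, 0 < h j := fun j => (hh j).1
  set M : ℝ := ∑ k ∈ range K, L k with hM
  have hM0 : 0 ≤ M := sum_nonneg fun k _ => hL k
  set D0 : ℝ := 1 / h 1 ^ 2 - 1 / h 0 ^ 2 with hD0
  have hD00 : 0 ≤ D0 := by simp only [hD0]; rw [hf.2 0]; linarith [hlo _ (seqBox_shift hh (0 + 1))]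
  -- levels: 1/h n² ≥ n β₀
  have hlev : ∀ n : ℕ, (n : ℝ) * β₀ ≤ 1 / h n ^ 2 := by
    intro n
    rw [invSq_eq_of_memFlow hf n]
    have := mul_lower_le_drive hlo hh n
    have : 0 ≤ 1 / gIR ^ 2 := by positivity
    linarith
  -- choose N₀
  obtain ⟨N1, hN1⟩ := exists_nat_ge (D0 * (5 * ((K : ℝ) + 1)) / β₀)
  obtain ⟨N2, hN2⟩ := exists_nat_ge (4 * M ^ 2 / (27 * β₀ ^ 3) + 1)
  refine ⟨max N1 N2 + 1, fun n hn => ⟨?_, ?_⟩⟩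
  · -- u_n ≤ D0 / a_{n+1} ≤ D0 / ((n+1) β₀) ≤ 1/(5(K+1))
    have hinc : 1 / h (n + 1) ^ 2 - 1 / h n ^ 2 ≤ D0 := by
      simp only [hD0]; rw [hf.2 n, hf.2 0]; have := increment_anti hmono hβ hlo hh hf (Nat.zero_le n); linarith
    have ha : ((n : ℝ) + 1) * β₀ ≤ 1 / h (n + 1) ^ 2 := by have := hlev (n + 1); push_cast at this; exact this
    have hn1 : (N1 : ℝ) ≤ n := by exact_mod_cast (le_max_left N1 N2).trans (Nat.le_of_succ_le hn)
    have hK : (0 : ℝ) < 5 * ((K : ℝ) + 1) := by positivity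
    have hnb : D0 * (5 * ((K : ℝ) + 1)) ≤ ((n : ℝ) + 1) * β₀ := by
      have := (div_le_iff₀ hβ).mp (hN1.trans hn1); nlinarith
    have h1sq : 0 < h (n + 1) ^ 2 := pow_pos (hpos _) 2
    rw [le_div_iff₀ hK]
    have e : (1 / h (n + 1) ^ 2 - 1 / h n ^ 2) * h (n + 1) ^ 2 * (5 * ((K : ℝ) + 1))
        = (1 / h (n + 1) ^ 2 - 1 / h n ^ 2) * (5 * ((K : ℝ) + 1)) * h (n + 1) ^ 2 := by ring
    rw [e]
    have hinc0 : 0 ≤ 1 / h (n + 1) ^ 2 - 1 / h n ^ 2 := by rw [hf.2 n]; linarith [hlo _ (seqBox_shift hh (n + 1))]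
    calc (1 / h (n + 1) ^ 2 - 1 / h n ^ 2) * (5 * ((K : ℝ) + 1)) * h (n + 1) ^ 2
        ≤ D0 * (5 * ((K : ℝ) + 1)) * h (n + 1) ^ 2 := by gcongr
      _ ≤ (((n : ℝ) + 1) * β₀) * h (n + 1) ^ 2 := mul_le_mul_of_nonneg_right hnb h1sq.le
      _ ≤ (1 / h (n + 1) ^ 2) * h (n + 1) ^ 2 := mul_le_mul_of_nonneg_right ha h1sq.le
      _ = 1 := one_div_mul_cancel h1sq.ne'
  · -- M h_n ≤ (3√3/2) β₀  ⟸  M² h_n² ≤ (27/4) β₀²  ⟸  M² ≤ (27/4) β₀² · n β₀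
    have hn2 : 4 * M ^ 2 / (27 * β₀ ^ 3) + 1 ≤ (n : ℝ) := by
      have : (N2 : ℝ) ≤ n := by exact_mod_cast (le_max_right N1 N2).trans (Nat.le_of_succ_le hn)
      exact hN2.trans this
    have h4M : (0:ℝ) ≤ 4 * M ^ 2 / (27 * β₀ ^ 3) := by positivity
    have hn0 : (0 : ℝ) < n := by linarith
    have ha : (n : ℝ) * β₀ ≤ 1 / h n ^ 2 := hlev n
    have hhn := hpos n
    -- h n² ≤ 1/(n β₀)
    have hsq : h n ^ 2 ≤ 1 / ((n : ℝ) * β₀) := by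
      rw [le_div_iff₀ (by positivity), mul_comm]
      have := mul_le_mul_of_nonneg_right ha (sq_nonneg (h n))
      rwa [one_div_mul_cancel (pow_pos hhn 2).ne'] at this
    have h33 : (3 * Real.sqrt 3 / 2 * β₀) ^ 2 = 27 / 4 * β₀ ^ 2 := by
      have : Real.sqrt 3 ^ 2 = 3 := Real.sq_sqrt (by norm_num)
      nlinarith [this]
    have htarget : (M * h n) ^ 2 ≤ (3 * Real.sqrt 3 / 2 * β₀) ^ 2 := by
      rw [h33, mul_pow]
      have h1 : M ^ 2 * h n ^ 2 ≤ M ^ 2 * (1 / ((n : ℝ) * β₀)) := mul_le_mul_of_nonneg_left hsq (sq_nonneg M)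
      have h2 : M ^ 2 * (1 / ((n : ℝ) * β₀)) ≤ 27 / 4 * β₀ ^ 2 := by
        rw [mul_one_div, div_le_iff₀ (by positivity)]
        have : 4 * M ^ 2 ≤ 27 * β₀ ^ 3 * ((n : ℝ) - 1) := by
          have := (div_le_iff₀ (by positivity : (0:ℝ) < 27 * β₀ ^ 3)).mp (by linarith : 4 * M ^ 2 / (27 * β₀ ^ 3) ≤ (n : ℝ) - 1)
          linarith
        nlinarith [pow_pos hβ 3]
      exact h1.trans h2
    exact (pow_le_pow_iff_left₀ (mul_nonneg hM0 hhn.le) (by positivity) two_ne_zero).1 htarget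

end Summit.QuantumFields.BalabanUV.Beta.EriceRemainderEnclosureHistoryAutonomyComparisonNonlinearLevelGaugePrep

end
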